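import Summits.CriticalPhenomena.SAWScalingLimit.Theorems.SAWDevelopingMapNoFoldBoundInteriorModes

/-!
# `NoFoldBound`, line Ideator3Sketch — interior vertices III: reduction to slit coherence, both ways

Crux `NoFoldBound` (stmt-CriticalPhenomena-8296), route `SAWDevelopingMap`. `interior_core` /
`interior_of_hyps`: port renewal + slit simple connectivity + the slit-coherence inequality
(`stub_slitCoherence`, the open core) give the no-fold inequality at every interior vertex for
every labelling; `slitCoherence_of_noFoldBound`: conversely `NoFoldBound` gives slit coherence.
Hence, once the combinatorial stubs land, `NoFoldBound ⇔ SourceLoopBound ∧ SlitCoherence`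
(with `sourceLoopBound_of_noFoldBound` and the boundary-layer theorem).
-/

noncomputable section

open scoped BigOperators
open Literature.Probability.LatticeModels Literature.Probability.RandomPlanarGeometry.SAW

namespace Summit.CriticalPhenomena.SAWScalingLimit.Theorems.SAWDevelopingMapNoFoldBound

/-- **Interior core (positive labelling).** At a vertex `v` off the source mid-edge all of whose
neighbours lie in `Λ`, for the labelling `(w₀, w₁, w₂)` in the positive order (turn
`w₀ → v → w₁ = +π/3`): from port renewal (`hPR`), slit simple connectivity (`hSSC`) and slit
coherence with constant `k` (`hCoh`), the six labelled no-fold inequalities hold with `max k 0`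
(the three cyclic labellings are the coherence inequality up to a unit, the three anti-cyclic
ones have a vanishing Beltrami mode — DCS Lemma 1 at `v`, here term by term). [folklore] -/
theorem interior_core
    (hPR : ∀ (Λ : Finset HexVertex) (a : Sym2 HexVertex) (v w₀ w₁ w₂ : HexVertex), v ∈ Λ → v ∉ a →
      hexGraph.Adj v w₀ → hexGraph.Adj v w₁ → hexGraph.Adj v w₂ → w₀ ≠ w₁ → w₁ ≠ w₂ → w₀ ≠ w₂ →
      ∀ (x σ : ℝ),
        hexParafermionicObservable Λ a x σ s(v, w₀) =
          (∑ γ : HexMidEdgeSAW Λ a s(v, w₀), if v ∉ γ.verts then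
              γ.weight x σ * hexParafermionicObservable (Λ \ γ.verts.toFinset) s(w₀, v) x σ s(v, w₀)
            else 0) +
          (∑ γ : HexMidEdgeSAW Λ a s(v, w₁), if v ∉ γ.verts then
              γ.weight x σ * hexParafermionicObservable (Λ \ γ.verts.toFinset) s(w₁, v) x σ s(v, w₀)
            else 0) +
          (∑ γ : HexMidEdgeSAW Λ a s(v, w₂), if v ∉ γ.verts then
              γ.weight x σ * hexParafermionicObservable (Λ \ γ.verts.toFinset) s(w₂, v) x σ s(v, w₀)
            else 0))
    (hSSC : ∀ (Λ : Finset HexVertex), hexDomainSimplyConnected Λ → ∀ a ∈ hexDomainBoundary Λ,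
      ∀ (z : Sym2 HexVertex) (γ : HexMidEdgeSAW Λ a z), hexDomainSimplyConnected (Λ \ γ.verts.toFinset))
    {k : ℝ}
    (hCoh : ∀ (Λ : Finset HexVertex), hexDomainSimplyConnected Λ →
      ∀ a ∈ hexDomainBoundary Λ, ∀ v ∈ Λ, v ∉ a → (∀ u : HexVertex, hexGraph.Adj v u → u ∈ Λ) →
      ∀ w₀ w₁ w₂ : HexVertex, hexGraph.Adj v w₀ → hexGraph.Adj v w₁ → hexGraph.Adj v w₂ →
      w₀ ≠ w₁ → w₁ ≠ w₂ → w₀ ≠ w₂ →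
      winding [hexMidpoint s(w₀, v), hexCenter v, hexMidpoint s(v, w₁)] = Real.pi / 3 →
      let x : ℝ := hexCriticalFugacity
      let α : ℝ := 1 + 2 * hexCriticalFugacity * Real.cos (5 * Real.pi / 24)
      let β : ℝ := 1 + 2 * hexCriticalFugacity * Real.cos (11 * Real.pi / 24)
      let ω : ℂ := Complex.exp (2 * Real.pi * Complex.I / 3)
      let Z : (w p q : HexVertex) → HexMidEdgeSAW Λ a s(v, w) → ℝ :=
        fun w p q (γ : HexMidEdgeSAW Λ a s(v, w)) =>
        ∑ δ : HexMidEdgeSAW ((Λ \ γ.verts.toFinset).erase v) s(v, p) s(v, q), x ^ δ.length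
      let B : (w p q : HexVertex) → ℂ := fun w p q =>
        ∑ γ : HexMidEdgeSAW Λ a s(v, w), if v ∉ γ.verts then
          γ.weight x (5 / 8) * ((β + Real.sqrt 3 * x * Z w p q γ : ℝ) : ℂ) else 0
      let S : (w p q : HexVertex) → ℂ := fun w p q =>
        ∑ γ : HexMidEdgeSAW Λ a s(v, w), if v ∉ γ.verts then
          γ.weight x (5 / 8) * ((α - Real.sqrt 3 * x * Z w p q γ : ℝ) : ℂ) else 0
      ‖B w₀ w₁ w₂ + ω * B w₁ w₂ w₀ + ω ^ 2 * B w₂ w₀ w₁‖ ≤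
        k * ‖S w₀ w₁ w₂ + S w₁ w₂ w₀ + S w₂ w₀ w₁‖)
    {Λ : Finset HexVertex} (hΛ : hexDomainSimplyConnected Λ) {a : Sym2 HexVertex}
    (ha : a ∈ hexDomainBoundary Λ) {v : HexVertex} (hv : v ∈ Λ) (hva : v ∉ a)
    (hint : ∀ u : HexVertex, hexGraph.Adj v u → u ∈ Λ) {w₀ w₁ w₂ : HexVertex}
    (h₀ : hexGraph.Adj v w₀) (h₁ : hexGraph.Adj v w₁) (h₂ : hexGraph.Adj v w₂)
    (h₀₁ : w₀ ≠ w₁) (h₁₂ : w₁ ≠ w₂) (h₀₂ : w₀ ≠ w₂)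
    (hchir : winding [hexMidpoint s(w₀, v), hexCenter v, hexMidpoint s(v, w₁)] = Real.pi / 3) :
    let F : Sym2 HexVertex → ℂ := hexParafermionicObservable Λ a hexCriticalFugacity (5 / 8)
    let ω : ℂ := Complex.exp (2 * Real.pi * Complex.I / 3)
    let S : ℝ := ‖F s(v, w₀) + F s(v, w₁) + F s(v, w₂)‖
    ‖F s(v, w₀) + ω * F s(v, w₁) + ω ^ 2 * F s(v, w₂)‖ ≤ max k 0 * S ∧
    ‖F s(v, w₀) + ω * F s(v, w₂) + ω ^ 2 * F s(v, w₁)‖ ≤ max k 0 * S ∧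
    ‖F s(v, w₁) + ω * F s(v, w₀) + ω ^ 2 * F s(v, w₂)‖ ≤ max k 0 * S ∧
    ‖F s(v, w₁) + ω * F s(v, w₂) + ω ^ 2 * F s(v, w₀)‖ ≤ max k 0 * S ∧
    ‖F s(v, w₂) + ω * F s(v, w₀) + ω ^ 2 * F s(v, w₁)‖ ≤ max k 0 * S ∧
    ‖F s(v, w₂) + ω * F s(v, w₁) + ω ^ 2 * F s(v, w₀)‖ ≤ max k 0 * S := by
  dsimp only
  obtain ⟨eSum, eBelt, eDCS⟩ := interior_modes hPR hSSC hΛ ha hv hva h₀ h₁ h₂ h₀₁ h₁₂ h₀₂ hchir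
  have HC := hCoh Λ hΛ a ha v hv hva hint w₀ w₁ w₂ h₀ h₁ h₂ h₀₁ h₁₂ h₀₂ hchir
  dsimp only at HC eSum eBelt eDCS
  set ω : ℂ := Complex.exp (2 * Real.pi * Complex.I / 3) with hω
  have hω3 : ω ^ 3 = 1 := omega_pow_three
  have hω1 : ‖ω‖ = 1 := norm_omega
  set F0 := hexParafermionicObservable Λ a hexCriticalFugacity (5 / 8) s(v, w₀) with hF0
  set F1 := hexParafermionicObservable Λ a hexCriticalFugacity (5 / 8) s(v, w₁) with hF1
  set F2 := hexParafermionicObservable Λ a hexCriticalFugacity (5 / 8) s(v, w₂) with hF2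
  have hk0 : k ≤ max k 0 := le_max_left _ _
  have hS : 0 ≤ ‖F0 + F1 + F2‖ := norm_nonneg _
  have main : ‖F0 + ω * F1 + ω ^ 2 * F2‖ ≤ max k 0 * ‖F0 + F1 + F2‖ := by
    rw [eBelt, eSum] at *
    exact HC.trans (mul_le_mul_of_nonneg_right hk0 hS)
  have zero : (0 : ℝ) ≤ max k 0 * ‖F0 + F1 + F2‖ := mul_nonneg (le_max_right _ _) hS
  refine ⟨main, by rw [eDCS, norm_zero]; exact zero, ?_, ?_, ?_, ?_⟩
  · rw [show F1 + ω * F0 + ω ^ 2 * F2 = ω * (F0 + ω * F2 + ω ^ 2 * F1) by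
      linear_combination (-F1) * hω3, eDCS, mul_zero, norm_zero]
    exact zero
  · rw [show F1 + ω * F2 + ω ^ 2 * F0 = ω ^ 2 * (F0 + ω * F1 + ω ^ 2 * F2) by
      linear_combination (-F1 - ω * F2) * hω3, norm_mul, norm_pow, hω1, one_pow, one_mul]
    exact main
  · rw [show F2 + ω * F0 + ω ^ 2 * F1 = ω * (F0 + ω * F1 + ω ^ 2 * F2) by
      linear_combination (-F2) * hω3, norm_mul, hω1, one_mul]
    exact main
  · rw [show F2 + ω * F1 + ω ^ 2 * F0 = ω ^ 2 * (F0 + ω * F2 + ω ^ 2 * F1) by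
      linear_combination (-F2 - ω * F1) * hω3, eDCS, mul_zero, norm_zero]
    exact zero

/-- **The interior stratum from the three interior stubs** (lead's glue, hypotheses form): port
renewal, slit simple connectivity and slit coherence (with its `k < 1`) give the no-fold
inequality with `max k 0 < 1` at every vertex off the source mid-edge all of whose neighbours lie
in the domain, for every labelling (positive labellings: `interior_core`; a negative labelling is a
positive one with `w₁, w₂` exchanged; bookkeeping by `six_labellings`). [folklore] -/
theorem interior_of_hyps
    (hPR : ∀ (Λ : Finset HexVertex) (a : Sym2 HexVertex) (v w₀ w₁ w₂ : HexVertex), v ∈ Λ → v ∉ a →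
      hexGraph.Adj v w₀ → hexGraph.Adj v w₁ → hexGraph.Adj v w₂ → w₀ ≠ w₁ → w₁ ≠ w₂ → w₀ ≠ w₂ →
      ∀ (x σ : ℝ),
        hexParafermionicObservable Λ a x σ s(v, w₀) =
          (∑ γ : HexMidEdgeSAW Λ a s(v, w₀), if v ∉ γ.verts then
              γ.weight x σ * hexParafermionicObservable (Λ \ γ.verts.toFinset) s(w₀, v) x σ s(v, w₀)
            else 0) +
          (∑ γ : HexMidEdgeSAW Λ a s(v, w₁), if v ∉ γ.verts then
              γ.weight x σ * hexParafermionicObservable (Λ \ γ.verts.toFinset) s(w₁, v) x σ s(v, w₀)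
            else 0) +
          (∑ γ : HexMidEdgeSAW Λ a s(v, w₂), if v ∉ γ.verts then
              γ.weight x σ * hexParafermionicObservable (Λ \ γ.verts.toFinset) s(w₂, v) x σ s(v, w₀)
            else 0))
    (hSSC : ∀ (Λ : Finset HexVertex), hexDomainSimplyConnected Λ → ∀ a ∈ hexDomainBoundary Λ,
      ∀ (z : Sym2 HexVertex) (γ : HexMidEdgeSAW Λ a z),
        hexDomainSimplyConnected (Λ \ γ.verts.toFinset))
    (hCohEx : ∃ k : ℝ, k < 1 ∧ ∀ (Λ : Finset HexVertex), hexDomainSimplyConnected Λ →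
      ∀ a ∈ hexDomainBoundary Λ, ∀ v ∈ Λ, v ∉ a → (∀ u : HexVertex, hexGraph.Adj v u → u ∈ Λ) →
      ∀ w₀ w₁ w₂ : HexVertex, hexGraph.Adj v w₀ → hexGraph.Adj v w₁ → hexGraph.Adj v w₂ →
      w₀ ≠ w₁ → w₁ ≠ w₂ → w₀ ≠ w₂ →
      winding [hexMidpoint s(w₀, v), hexCenter v, hexMidpoint s(v, w₁)] = Real.pi / 3 →
      let x : ℝ := hexCriticalFugacity
      let α : ℝ := 1 + 2 * hexCriticalFugacity * Real.cos (5 * Real.pi / 24)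
      let β : ℝ := 1 + 2 * hexCriticalFugacity * Real.cos (11 * Real.pi / 24)
      let ω : ℂ := Complex.exp (2 * Real.pi * Complex.I / 3)
      let Z : (w p q : HexVertex) → HexMidEdgeSAW Λ a s(v, w) → ℝ :=
        fun w p q (γ : HexMidEdgeSAW Λ a s(v, w)) =>
        ∑ δ : HexMidEdgeSAW ((Λ \ γ.verts.toFinset).erase v) s(v, p) s(v, q), x ^ δ.length
      let B : (w p q : HexVertex) → ℂ := fun w p q =>
        ∑ γ : HexMidEdgeSAW Λ a s(v, w), if v ∉ γ.verts then
          γ.weight x (5 / 8) * ((β + Real.sqrt 3 * x * Z w p q γ : ℝ) : ℂ) else 0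
      let S : (w p q : HexVertex) → ℂ := fun w p q =>
        ∑ γ : HexMidEdgeSAW Λ a s(v, w), if v ∉ γ.verts then
          γ.weight x (5 / 8) * ((α - Real.sqrt 3 * x * Z w p q γ : ℝ) : ℂ) else 0
      ‖B w₀ w₁ w₂ + ω * B w₁ w₂ w₀ + ω ^ 2 * B w₂ w₀ w₁‖ ≤
        k * ‖S w₀ w₁ w₂ + S w₁ w₂ w₀ + S w₂ w₀ w₁‖) :
    ∃ k : ℝ, k < 1 ∧ ∀ (Λ : Finset HexVertex), hexDomainSimplyConnected Λ →
      ∀ a ∈ hexDomainBoundary Λ, ∀ v ∈ Λ, v ∉ a → (∀ u : HexVertex, hexGraph.Adj v u → u ∈ Λ) →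
      ∀ w₀ w₁ w₂ : HexVertex, hexGraph.Adj v w₀ → hexGraph.Adj v w₁ → hexGraph.Adj v w₂ →
      w₀ ≠ w₁ → w₁ ≠ w₂ → w₀ ≠ w₂ →
      let F : Sym2 HexVertex → ℂ := hexParafermionicObservable Λ a hexCriticalFugacity (5 / 8)
      let ω : ℂ := Complex.exp (2 * Real.pi * Complex.I / 3)
      ‖F s(v, w₀) + ω * F s(v, w₁) + ω ^ 2 * F s(v, w₂)‖ ≤
        k * ‖F s(v, w₀) + F s(v, w₁) + F s(v, w₂)‖ := by
  obtain ⟨k, hk, hCoh⟩ := hCohEx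
  refine ⟨max k 0, max_lt hk one_pos, ?_⟩
  intro Λ hΛ a ha v hv hva hint w₀ w₁ w₂ h₀ h₁ h₂ h₀₁ h₁₂ h₀₂
  dsimp only
  obtain ⟨ε, hε, T01, -, -, -, -, T02⟩ := stub_localTurns v w₀ w₁ w₂ h₀ h₁ h₂ h₀₁ h₁₂ h₀₂
  rcases hε with rfl | rfl
  · have hchir : winding [hexMidpoint s(w₀, v), hexCenter v, hexMidpoint s(v, w₁)] = Real.pi / 3 := by
      rw [T01]; ring
    have h6 := interior_core hPR hSSC hCoh hΛ ha hv hva hint h₀ h₁ h₂ h₀₁ h₁₂ h₀₂ hchir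
    exact six_labellings (fun w => hexParafermionicObservable Λ a hexCriticalFugacity (5 / 8) s(v, w))
      w₀ w₁ w₂ (max k 0) h6 (Or.inl rfl) (Or.inr (Or.inl rfl)) (Or.inr (Or.inr rfl)) h₀₁ h₁₂ h₀₂
  · have hchir : winding [hexMidpoint s(w₀, v), hexCenter v, hexMidpoint s(v, w₂)] = Real.pi / 3 := by
      rw [T02]; ring
    have h6 := interior_core hPR hSSC hCoh hΛ ha hv hva hint h₀ h₂ h₁ h₀₂ h₁₂.symm h₀₁ hchir
    exact six_labellings (fun w => hexParafermionicObservable Λ a hexCriticalFugacity (5 / 8) s(v, w))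
      w₀ w₂ w₁ (max k 0) h6 (Or.inl rfl) (Or.inr (Or.inr rfl)) (Or.inr (Or.inl rfl)) h₀₁ h₁₂ h₀₂

/-- **Conversely, `NoFoldBound` implies slit coherence** (given port renewal and slit simple
connectivity): the slit-coherence inequality IS the no-fold inequality at an interior vertex in
the positive labelling, read through `interior_modes`; so the open core `stub_slitCoherence` is
exactly the interior residual of the crux, not a strengthening. [folklore] -/
theorem slitCoherence_of_noFoldBound
    (hPR : ∀ (Λ : Finset HexVertex) (a : Sym2 HexVertex) (v w₀ w₁ w₂ : HexVertex), v ∈ Λ → v ∉ a →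
      hexGraph.Adj v w₀ → hexGraph.Adj v w₁ → hexGraph.Adj v w₂ → w₀ ≠ w₁ → w₁ ≠ w₂ → w₀ ≠ w₂ →
      ∀ (x σ : ℝ),
        hexParafermionicObservable Λ a x σ s(v, w₀) =
          (∑ γ : HexMidEdgeSAW Λ a s(v, w₀), if v ∉ γ.verts then
              γ.weight x σ * hexParafermionicObservable (Λ \ γ.verts.toFinset) s(w₀, v) x σ s(v, w₀)
            else 0) +
          (∑ γ : HexMidEdgeSAW Λ a s(v, w₁), if v ∉ γ.verts then
              γ.weight x σ * hexParafermionicObservable (Λ \ γ.verts.toFinset) s(w₁, v) x σ s(v, w₀)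
            else 0) +
          (∑ γ : HexMidEdgeSAW Λ a s(v, w₂), if v ∉ γ.verts then
              γ.weight x σ * hexParafermionicObservable (Λ \ γ.verts.toFinset) s(w₂, v) x σ s(v, w₀)
            else 0))
    (hSSC : ∀ (Λ : Finset HexVertex), hexDomainSimplyConnected Λ → ∀ a ∈ hexDomainBoundary Λ,
      ∀ (z : Sym2 HexVertex) (γ : HexMidEdgeSAW Λ a z),
        hexDomainSimplyConnected (Λ \ γ.verts.toFinset))
    (h : Summit.CriticalPhenomena.SAWScalingLimit.Theses.SAWDevelopingMap.NoFoldBound) :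
    ∃ k : ℝ, k < 1 ∧ ∀ (Λ : Finset HexVertex), hexDomainSimplyConnected Λ →
      ∀ a ∈ hexDomainBoundary Λ, ∀ v ∈ Λ, v ∉ a → (∀ u : HexVertex, hexGraph.Adj v u → u ∈ Λ) →
      ∀ w₀ w₁ w₂ : HexVertex, hexGraph.Adj v w₀ → hexGraph.Adj v w₁ → hexGraph.Adj v w₂ →
      w₀ ≠ w₁ → w₁ ≠ w₂ → w₀ ≠ w₂ →
      winding [hexMidpoint s(w₀, v), hexCenter v, hexMidpoint s(v, w₁)] = Real.pi / 3 →
      let x : ℝ := hexCriticalFugacity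
      let α : ℝ := 1 + 2 * hexCriticalFugacity * Real.cos (5 * Real.pi / 24)
      let β : ℝ := 1 + 2 * hexCriticalFugacity * Real.cos (11 * Real.pi / 24)
      let ω : ℂ := Complex.exp (2 * Real.pi * Complex.I / 3)
      let Z : (w p q : HexVertex) → HexMidEdgeSAW Λ a s(v, w) → ℝ :=
        fun w p q (γ : HexMidEdgeSAW Λ a s(v, w)) =>
        ∑ δ : HexMidEdgeSAW ((Λ \ γ.verts.toFinset).erase v) s(v, p) s(v, q), x ^ δ.length
      let B : (w p q : HexVertex) → ℂ := fun w p q =>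
        ∑ γ : HexMidEdgeSAW Λ a s(v, w), if v ∉ γ.verts then
          γ.weight x (5 / 8) * ((β + Real.sqrt 3 * x * Z w p q γ : ℝ) : ℂ) else 0
      let S : (w p q : HexVertex) → ℂ := fun w p q =>
        ∑ γ : HexMidEdgeSAW Λ a s(v, w), if v ∉ γ.verts then
          γ.weight x (5 / 8) * ((α - Real.sqrt 3 * x * Z w p q γ : ℝ) : ℂ) else 0
      ‖B w₀ w₁ w₂ + ω * B w₁ w₂ w₀ + ω ^ 2 * B w₂ w₀ w₁‖ ≤
        k * ‖S w₀ w₁ w₂ + S w₁ w₂ w₀ + S w₂ w₀ w₁‖ := by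
  obtain ⟨k, hk, H⟩ := h
  refine ⟨k, hk, ?_⟩
  intro Λ hΛ a ha v hv hva hint w₀ w₁ w₂ h₀ h₁ h₂ h₀₁ h₁₂ h₀₂ hchir
  dsimp only
  obtain ⟨eSum, eBelt, -⟩ := interior_modes hPR hSSC hΛ ha hv hva h₀ h₁ h₂ h₀₁ h₁₂ h₀₂ hchir
  have H1 := H Λ hΛ a ha v hv w₀ w₁ w₂ h₀ h₁ h₂ h₀₁ h₁₂ h₀₂
  dsimp only at H1 eSum eBelt
  rw [eBelt, eSum] at H1
  exact H1

end Summit.CriticalPhenomena.SAWScalingLimit.Theorems.SAWDevelopingMapNoFoldBound
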